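import Literature.Computation.Certificates.SemidefiniteRigorousBounds
import Literature.Computation.Certificates.Data
import HarnessLib

/-!
# Sparse, access-linear kernel replay of gram-mode certsdp certificates (gauge-boot L4 support)

HONEST FRAMING (cell `pub-gaugeboot`): certified bounds on lattice expectations at stated coupling,
gauge group, dimension and torus size; NOT a mass gap, NOT a continuum limit, NOT a string tension;
NOT Yang–Mills-summit-bearing (barriers `FixedCouplingUltralocality`, `PerturbativeInvisibility`).

Generic part of the cell-side certificate emitter `gb_lean_emit` 0.7 "sparse" (FANOUT-PLAN A27).  The
0.6 replays (`Certificates/R0D?b*.lean`, blocks ≤ 49, ≤ 12 variables) let the kernel evaluate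
`Matrix`/`Finset` terms directly (`O(n⁴)` list accesses per Gram block, one full block scan per
variable) — out of reach for the §C window certificates (N1 `glyz-c1` 3D rows: 435 variables, 103
rows, blocks 85/46/46).  Here every kernel-side quantity is a STRUCTURAL recursion over plain `List`
data with linear access, every check is a `Bool` proved `= true` by `decide +kernel` over an index
RANGE (so that no single kernel reduction exceeds the farm memory cap, cf.
`Literature/Computation/Certificates/Blocks.lean`), and the lemmas below turn the checks into the
`Matrix`/`Finset` facts consumed by `JanssonChaykinKeil.lmiForm_bound` (Jansson–Chaykin–Keil 2007):
Gram duals without a materialised `Z` (`zmat G n i j = listDot Gᵢ Gⱼ = (Gm Gmᵀ) i j`, `zr = zmat/4^K ⪰ 0`);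
class-table blocks (`cls`, `fz`, `gram`, binding interface `gram_apply`); traces
`tr (zr · fz v) = T[v]/4^K` from per-variable position lists (`posCheck`, `coverCheck`); the sparse
equality rows, residual table, scalar identity and the assembled abstract bound live in the sequel
`Certificates/SparseBound.lean`.  All `[folklore]`; nothing here is specific to lattice gauge theory.
-/

namespace Summit.QuantumFields.GaugeBoot.Certificates.Sparse

open Matrix Finset Literature.Computation.Certificates

/-! ## Kernel-side primitives -/

/-- `natAll n f = f 0 && … && f (n-1)`. [folklore] -/
def natAll (n : ℕ) (f : ℕ → Bool) : Bool := (List.range n).all f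

/-- Specification of `natAll`. [folklore] -/
theorem natAll_iff {n : ℕ} {f : ℕ → Bool} : natAll n f = true ↔ ∀ i < n, f i = true := by
  simp [natAll, List.all_eq_true, List.mem_range]

/-- Dot product of two integer lists, stopping at the shorter one. [folklore] -/
def listDot : List ℤ → List ℤ → ℤ
  | a :: as, b :: bs => a * b + listDot as bs
  | _, _ => 0

/-- `listDot [] b = 0`. [folklore] -/
@[simp] theorem listDot_nil_left (b : List ℤ) : listDot [] b = 0 := by cases b <;> rfl

/-- `listDot a [] = 0`. [folklore] -/
@[simp] theorem listDot_nil_right (a : List ℤ) : listDot a [] = 0 := by cases a <;> rfl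

/-- `listDot` on two `cons`es. [folklore] -/
@[simp] theorem listDot_cons_cons (x y : ℤ) (as bs : List ℤ) :
    listDot (x :: as) (y :: bs) = x * y + listDot as bs := rfl

/-- `listDot a b` is the `Fin m`-indexed sum of products of the (zero-padded) entries whenever the
first list fits into `m` slots. [folklore] -/
theorem listDot_eq_sum : ∀ (m : ℕ) (a b : List ℤ), a.length ≤ m →
    listDot a b = ∑ l : Fin m, a.getD l.val 0 * b.getD l.val 0
  | 0, a, b, h => by
      have ha : a = [] := List.eq_nil_of_length_eq_zero (Nat.le_zero.mp h)
      subst ha; simp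
  | _ + 1, [], b, _ => by simp
  | _ + 1, x :: as, [], _ => by simp
  | m + 1, x :: as, y :: bs, h => by
      rw [listDot_cons_cons, Fin.sum_univ_succ]
      simp only [Fin.val_zero, Fin.val_succ, List.getD_cons_zero, List.getD_cons_succ]
      rw [listDot_eq_sum m as bs (by simpa using h)]

/-- A list sum as a `Fin m`-indexed sum over zero-padded entries. [folklore] -/
theorem sum_map_eq_sum_fin {α M : Type*} [AddCommMonoid M] (f : α → M) (d : α) (hd : f d = 0) :
    ∀ (m : ℕ) (L : List α), L.length ≤ m → (L.map f).sum = ∑ e : Fin m, f (L.getD e.val d)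
  | 0, L, h => by
      have hL : L = [] := List.eq_nil_of_length_eq_zero (Nat.le_zero.mp h)
      subst hL; simp
  | _ + 1, [], _ => by simp [hd]
  | m + 1, x :: xs, h => by
      rw [List.map_cons, List.sum_cons, Fin.sum_univ_succ]
      simp only [Fin.val_zero, Fin.val_succ, List.getD_cons_zero, List.getD_cons_succ]
      rw [sum_map_eq_sum_fin f d hd m xs (by simpa using h)]

/-! ## Gram dual blocks from factor rows (no materialised `Z`) -/

/-- Every factor row has length `≤ n`. [folklore] -/
def lenCheck (G : List (List ℤ)) (n : ℕ) : Bool := natAll n fun i => (G.getD i []).length ≤ n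

/-- `Z = G Gᵀ` given entrywise by list dot products of the factor rows. [folklore] -/
def zmat (G : List (List ℤ)) (n : ℕ) : Matrix (Fin n) (Fin n) ℤ :=
  Matrix.of fun i j => listDot (G.getD i.val []) (G.getD j.val [])

/-- `zmat G n = Gm Gmᵀ` with `Gm = matrixOfRows n n G`. [folklore] -/
theorem zmat_eq_mul {G : List (List ℤ)} {n : ℕ} (hlen : lenCheck G n = true) :
    zmat G n = matrixOfRows n n G * (matrixOfRows n n G)ᵀ := by
  ext i j
  have hi : (G.getD i.val []).length ≤ n := by
    have := natAll_iff.mp hlen i.val i.isLt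
    simpa using this
  rw [zmat, Matrix.of_apply, listDot_eq_sum n _ _ hi, Matrix.mul_apply]
  simp [Matrix.transpose_apply]

/-- The scaled dual block `Z / 4^K` as a real matrix. [folklore] -/
noncomputable def zr (G : List (List ℤ)) (n K : ℕ) : Matrix (Fin n) (Fin n) ℝ :=
  ((1 : ℝ) / 4 ^ K) • (zmat G n).map (Int.cast : ℤ → ℝ)

/-- **The dual block is PSD** (Gram form). [folklore] -/
theorem zr_posSemidef {G : List (List ℤ)} {n : ℕ} (K : ℕ) (hlen : lenCheck G n = true) :
    (zr G n K).PosSemidef := by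
  have hZ : (zmat G n).map (Int.cast : ℤ → ℝ) =
      (matrixOfRows n n G).map (Int.cast : ℤ → ℝ) * ((matrixOfRows n n G).map (Int.cast : ℤ → ℝ))ᴴ := by
    rw [conjTranspose_eq_transpose_of_trivial, zmat_eq_mul hlen]
    ext i j
    simp only [Matrix.map_apply, Matrix.mul_apply, Matrix.transpose_apply]
    push_cast
    rfl
  rw [zr, hZ]
  exact (posSemidef_self_mul_conjTranspose _).smul (by positivity)

/-! ## Class-table blocks -/

/-- Every class index is a variable index `< nv`. [folklore] -/
def clsLtCheck (C : List (List ℕ)) (n nv : ℕ) : Bool :=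
  natAll n fun i => natAll n fun j => (C.getD i []).getD j 0 < nv

/-- Soundness of `clsLtCheck`. [folklore] -/
theorem clsLt_of_check {C : List (List ℕ)} {n nv : ℕ} (h : clsLtCheck C n nv = true) (i j : Fin n) :
    (C.getD i.val []).getD j.val 0 < nv := by
  have := natAll_iff.mp (natAll_iff.mp h i.val i.isLt) j.val j.isLt
  simpa using this

/-- The class (variable index) of entry `(i, j)`. [folklore] -/
def cls (C : List (List ℕ)) {n nv : ℕ} (h : clsLtCheck C n nv = true) (i j : Fin n) : Fin nv :=
  ⟨(C.getD i.val []).getD j.val 0, clsLt_of_check h i j⟩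

/-- The `0/1` coefficient matrix `F_v` of variable `v` in a class-table block. [folklore] -/
def fz (C : List (List ℕ)) {n nv : ℕ} (h : clsLtCheck C n nv = true) (v : Fin nv) :
    Matrix (Fin n) (Fin n) ℤ :=
  Matrix.of fun i j => if cls C h i j = v then 1 else 0

/-- The block as a real matrix-valued linear form `M(y) = Σ_v y_v F_v`. [folklore] -/
noncomputable def gram (C : List (List ℕ)) {n nv : ℕ} (h : clsLtCheck C n nv = true)
    (y : Fin nv → ℝ) : Matrix (Fin n) (Fin n) ℝ :=
  ∑ v, y v • (fz C h v).map (Int.cast : ℤ → ℝ)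

/-- **Binding interface**: `M(y) i j = y (cls i j)`. [folklore] -/
theorem gram_apply (C : List (List ℕ)) {n nv : ℕ} (h : clsLtCheck C n nv = true)
    (y : Fin nv → ℝ) (i j : Fin n) : gram C h y i j = y (cls C h i j) := by
  simp only [gram, Matrix.sum_apply, Matrix.smul_apply, Matrix.map_apply, fz, Matrix.of_apply,
    smul_eq_mul]
  rw [Finset.sum_eq_single (cls C h i j) (fun v _ hv => by simp [Ne.symm hv])
    (fun h => absurd (Finset.mem_univ _) h)]
  simp

/-! ## Traces from position lists -/

/-- Boolean list membership of a pair of naturals. [folklore] -/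
def memPair (a b : ℕ) : List (ℕ × ℕ) → Bool
  | [] => false
  | q :: qs => (a == q.1 && b == q.2) || memPair a b qs

/-- Specification of `memPair`. [folklore] -/
theorem memPair_iff {a b : ℕ} : ∀ {l : List (ℕ × ℕ)}, memPair a b l = true ↔ (a, b) ∈ l
  | [] => by simp [memPair]
  | (q1, q2) :: qs => by simp [memPair, memPair_iff (l := qs)]

/-- Boolean duplicate-freeness of a list of pairs. [folklore] -/
def nodupPairs : List (ℕ × ℕ) → Bool
  | [] => true
  | p :: ps => !(memPair p.1 p.2 ps) && nodupPairs ps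

/-- Soundness of `nodupPairs`. [folklore] -/
theorem nodup_of_nodupPairs : ∀ {l : List (ℕ × ℕ)}, nodupPairs l = true → l.Nodup
  | [], _ => List.nodup_nil
  | (a, b) :: ps, h => by
      simp only [nodupPairs, Bool.and_eq_true, Bool.not_eq_true'] at h
      refine List.nodup_cons.mpr ⟨fun hm => ?_, nodup_of_nodupPairs h.2⟩
      have h1 := h.1
      rw [memPair_iff.mpr hm] at h1
      exact Bool.noConfusion h1

/-- Sum of the Gram entries `listDot Gᵢ Gⱼ` over a position list. [folklore] -/
def posSum (G : List (List ℤ)) : List (ℕ × ℕ) → ℤ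
  | [] => 0
  | p :: ps => listDot (G.getD p.1 []) (G.getD p.2 []) + posSum G ps

/-- `posSum` as a mapped list sum. [folklore] -/
theorem posSum_eq_sum_map (G : List (List ℤ)) :
    ∀ l : List (ℕ × ℕ), posSum G l = (l.map fun p => listDot (G.getD p.1 []) (G.getD p.2 [])).sum
  | [] => rfl
  | p :: ps => by simp [posSum, posSum_eq_sum_map G ps]

/-- Per-variable position check: every listed position `(i, j)` is in range and has class `v` at
`(j, i)`, the list is duplicate-free, and its Gram entries sum to `t`. [folklore] -/
def posVarCheck (C : List (List ℕ)) (G : List (List ℤ)) (n v : ℕ) (ps : List (ℕ × ℕ)) (t : ℤ) :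
    Bool :=
  ps.all (fun p => decide (p.1 < n) && decide (p.2 < n) && ((C.getD p.2 []).getD p.1 0 == v))
    && nodupPairs ps && (posSum G ps == t)

/-- Position checks for the variables `lo ≤ v < hi`. [folklore] -/
def posCheck (C : List (List ℕ)) (G : List (List ℤ)) (P : List (List (ℕ × ℕ))) (T : List ℤ)
    (n lo hi : ℕ) : Bool :=
  natAll (hi - lo) fun t => posVarCheck C G n (lo + t) (P.getD (lo + t) []) (T.getD (lo + t) 0)

/-- What `posCheck` establishes for the variables `lo ≤ v < hi`. [folklore] -/
def PosOK (C : List (List ℕ)) (G : List (List ℤ)) (P : List (List (ℕ × ℕ))) (T : List ℤ)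
    (n lo hi : ℕ) : Prop :=
  ∀ v, lo ≤ v → v < hi →
    (∀ p ∈ P.getD v [], p.1 < n ∧ p.2 < n ∧ (C.getD p.2 []).getD p.1 0 = v) ∧
      (P.getD v []).Nodup ∧ posSum G (P.getD v []) = T.getD v 0

/-- Soundness of `posCheck`. [folklore] -/
theorem posOK_of_check {C : List (List ℕ)} {G : List (List ℤ)} {P : List (List (ℕ × ℕ))}
    {T : List ℤ} {n lo hi : ℕ} (h : posCheck C G P T n lo hi = true) : PosOK C G P T n lo hi := by
  intro v hlo hhi
  have hv := natAll_iff.mp h (v - lo) (by omega)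
  rw [show lo + (v - lo) = v by omega] at hv
  simp only [posVarCheck, Bool.and_eq_true, List.all_eq_true, decide_eq_true_eq, beq_iff_eq] at hv
  obtain ⟨⟨hall, hnd⟩, hsum⟩ := hv
  exact ⟨fun p hp => by have := hall p hp; tauto, nodup_of_nodupPairs hnd, hsum⟩

/-- Concatenating variable ranges. [folklore] -/
theorem PosOK.append {C : List (List ℕ)} {G : List (List ℤ)} {P : List (List (ℕ × ℕ))}
    {T : List ℤ} {n lo mid hi : ℕ} (h1 : PosOK C G P T n lo mid) (h2 : PosOK C G P T n mid hi) :
    PosOK C G P T n lo hi := fun v hlo hhi =>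
  if hm : v < mid then h1 v hlo hm else h2 v (Nat.le_of_not_lt hm) hhi

/-- Cover check for the rows `lo ≤ i < hi`: every entry `(i, j)` is listed under the class of
`(j, i)`. [folklore] -/
def coverCheck (C : List (List ℕ)) (P : List (List (ℕ × ℕ))) (n lo hi : ℕ) : Bool :=
  natAll (hi - lo) fun t => natAll n fun j =>
    memPair (lo + t) j (P.getD ((C.getD j []).getD (lo + t) 0) [])

/-- What `coverCheck` establishes. [folklore] -/
def Covers (C : List (List ℕ)) (P : List (List (ℕ × ℕ))) (n lo hi : ℕ) : Prop :=
  ∀ i, lo ≤ i → i < hi → ∀ j < n, (i, j) ∈ P.getD ((C.getD j []).getD i 0) []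

/-- Soundness of `coverCheck`. [folklore] -/
theorem covers_of_check {C : List (List ℕ)} {P : List (List (ℕ × ℕ))} {n lo hi : ℕ}
    (h : coverCheck C P n lo hi = true) : Covers C P n lo hi := by
  intro i hlo hhi j hj
  have h1 := natAll_iff.mp (natAll_iff.mp h (i - lo) (by omega)) j hj
  rw [show lo + (i - lo) = i by omega] at h1
  exact memPair_iff.mp h1

/-- Concatenating row ranges. [folklore] -/
theorem Covers.append {C : List (List ℕ)} {P : List (List (ℕ × ℕ))} {n lo mid hi : ℕ}
    (h1 : Covers C P n lo mid) (h2 : Covers C P n mid hi) : Covers C P n lo hi :=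
  fun i hlo hhi j hj => if hm : i < mid then h1 i hlo hm j hj else h2 i (Nat.le_of_not_lt hm) hhi j hj

/-- The class-`v` part of the Gram block sums to `T[v]` (integer statement). [folklore] -/
theorem sum_ite_cls_eq {C : List (List ℕ)} {G : List (List ℤ)} {P : List (List (ℕ × ℕ))}
    {T : List ℤ} {n nv : ℕ} (hp : PosOK C G P T n 0 nv) (hc : Covers C P n 0 n) {v : ℕ}
    (hv : v < nv) :
    ∑ i : Fin n, ∑ j : Fin n,
        (if (C.getD j.val []).getD i.val 0 = v then listDot (G.getD i.val []) (G.getD j.val []) else 0) =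
      T.getD v 0 := by
  classical
  obtain ⟨hall, hnd, hsum⟩ := hp v (Nat.zero_le _) hv
  set ps := P.getD v [] with hps
  let g : ℕ × ℕ → ℤ := fun q => listDot (G.getD q.1 []) (G.getD q.2 [])
  let e : Fin n × Fin n ↪ ℕ × ℕ :=
    ⟨fun p => (p.1.val, p.2.val), fun p q hpq => by
      simp only [Prod.mk.injEq] at hpq
      exact Prod.ext (Fin.ext hpq.1) (Fin.ext hpq.2)⟩
  have hset : (Finset.univ.filter fun p : Fin n × Fin n =>
      (C.getD p.2.val []).getD p.1.val 0 = v).map e = ps.toFinset := by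
    ext q
    simp only [Finset.mem_map, Finset.mem_filter, Finset.mem_univ, true_and, List.mem_toFinset,
      Function.Embedding.coeFn_mk, e]
    constructor
    · rintro ⟨p, hpv, rfl⟩
      have := hc p.1.val (Nat.zero_le _) p.1.isLt p.2.val p.2.isLt
      rwa [hpv] at this
    · intro hq
      obtain ⟨h1, h2, h3⟩ := hall q hq
      exact ⟨(⟨q.1, h1⟩, ⟨q.2, h2⟩), h3, rfl⟩
  calc ∑ i : Fin n, ∑ j : Fin n,
        (if (C.getD j.val []).getD i.val 0 = v then listDot (G.getD i.val []) (G.getD j.val []) else 0)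
      = ∑ p : Fin n × Fin n, (if (C.getD p.2.val []).getD p.1.val 0 = v then g (e p) else 0) := by
        rw [← Fintype.sum_prod_type']
        rfl
    _ = ∑ p ∈ Finset.univ.filter (fun p : Fin n × Fin n => (C.getD p.2.val []).getD p.1.val 0 = v),
          g (e p) := by rw [Finset.sum_filter]
    _ = ∑ q ∈ (Finset.univ.filter fun p : Fin n × Fin n =>
          (C.getD p.2.val []).getD p.1.val 0 = v).map e, g q := by rw [Finset.sum_map]
    _ = ∑ q ∈ ps.toFinset, g q := by rw [hset]
    _ = (ps.map g).sum := List.sum_toFinset _ hnd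
    _ = T.getD v 0 := by rw [← posSum_eq_sum_map]; exact hsum

/-- **Trace identity**: `tr (Z/4^K · F_v) = T[v]/4^K`. [folklore] -/
theorem trace_zr_mul_fz {C : List (List ℕ)} {G : List (List ℤ)} {P : List (List (ℕ × ℕ))}
    {T : List ℤ} {n nv : ℕ} (K : ℕ) (hlt : clsLtCheck C n nv = true) (hp : PosOK C G P T n 0 nv)
    (hc : Covers C P n 0 n) (v : Fin nv) :
    trace (zr G n K * (fz C hlt v).map (Int.cast : ℤ → ℝ)) = ((T.getD v.val 0 : ℤ) : ℝ) / 4 ^ K := by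
  rw [← sum_ite_cls_eq hp hc v.isLt]
  have hterm : ∀ i j : Fin n,
      zr G n K i j * ((fz C hlt v).map (Int.cast : ℤ → ℝ)) j i =
        ((if (C.getD j.val []).getD i.val 0 = v.val then listDot (G.getD i.val []) (G.getD j.val [])
          else 0 : ℤ) : ℝ) / 4 ^ K := by
    intro i j
    have hiff : (cls C hlt j i = v) ↔ (C.getD j.val []).getD i.val 0 = v.val := by
      simp [cls, Fin.ext_iff]
    simp only [zr, zmat, fz, Matrix.smul_apply, Matrix.map_apply, Matrix.of_apply, smul_eq_mul]
    by_cases hcase : (C.getD j.val []).getD i.val 0 = v.val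
    · rw [if_pos (hiff.mpr hcase), if_pos hcase]; push_cast; ring
    · rw [if_neg (fun h' => hcase (hiff.mp h')), if_neg hcase]; push_cast; ring
  simp only [Matrix.trace, Matrix.diag_apply, Matrix.mul_apply, hterm]
  push_cast
  rw [Finset.sum_div]
  refine Finset.sum_congr rfl fun i _ => ?_
  rw [Finset.sum_div]

end Summit.QuantumFields.GaugeBoot.Certificates.Sparse
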